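import Mathlib
import HarnessLib
import Summits.HubbardSuperconductivity.HubbardSuperconductivity.Theorems.KLProgrammeKLRegimeAlphaWtClosedDatumRates
import Summits.HubbardSuperconductivity.HubbardSuperconductivity.Theorems.KLProgrammeKLRegimeAlphaWtScalars2

/-!
# Route `KLProgramme` — engine support, route (L2), FAT layer, WEIGHTED: **the uniform WEIGHTED per-pair bound in CLOSED FORM** for a
# SHIFTED slice `(Λₛ, Λ′]`, `Λ_{m+1} = r·Λₛ`, `r ≥ 1` (the door's `r = 16`), canonical cube-root-free rates, all five rate inequalities DISCHARGED

Cell `gate-hubbard-kl`, seat p3 (g10); program «W3α = α_w rows instance» (KL STATUS 2026-08-27 20:43Z), file (α2b): the weighted twin of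
k3c2-p3's `slicePair_bgmFat_closed` (`…AlphaFatClosed`).  Regime numerics as there (`Λ_m = 4Λ`, `N_r = 2^{m+1}`, `N_r²Λ = e₀`, `e₀ ≤ 1`, `β ≤ M`,
`π ≤ Λ_mβ`, the three window/zone thresholds in their THREE-STEP form) plus the order-three frame datum `‖D³e_K‖ ≤ A₃`, `A₃Λ_m² ≤ a₃`.
Rates: `s₀ = 2Λβ/(MπX₀)`, `s₁ = 2Λ/(πX₁)`, `s₂ = 2Λ/(π(N_r+½)X₁)`, `s₃ = 2/(π(N_r+½)N_r√q_v)` (k3c2-p3's anisotropic second-order rate),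
`s₃′ = 2Λ/(π(N_r+½)X₃)` with `X₀ = max 1 D_t3`, `X₁ = max 1 q₃ᵉ`, `X₃ = max 1 q₃ᵛ` (`q ≤ X³`, no cube roots).

* **`slicePairWt_bgmFat_closed_datum`** — (frame third derivative only via `K₃Λₛ² ≤ k₃`) (`Λ ↦ Λₛ`, `C_N` carries `r²`, `q_v` reads `e₀/r`) `Σ_z (1 + s₀|z̃₁| + s₁|z̃₂|₁)‖S[(βL²)⁻²F̃_ωF̃_{ω′}Ψ̂]‖(z) ≤ 4√(48·C_W·C_N)·(M/β)/Λ` with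
  `C_W = 64(1 + 5√2 + 5√2X₃)²·4096x₀(4(2√2x₂+2)(2√2x₃+1) + 160x₁(x₁+1)²/δ_L)`, `x₀ = πX₀/2`, `x₁ = πX₁/2`, `x₂ = 5πX₁/4`, `x₃ = 5π√q_v/4`.

Everything is proved; no definitions. [cite: BenfattoGiulianiMastropietro2006, §2.8 (2.81), §3 (3.3)]
-/

noncomputable section

namespace Summit.HubbardSuperconductivity.HubbardSuperconductivity.Theorems.TorusFourierL2

set_option linter.dupNamespace false -- summit = problem name (single-conjunct summit), D-0017

open Set Finset Literature.MathematicalPhysics.QuantumLattice Literature.MathematicalPhysics.QuantumLattice.BandSectorCounting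
open Literature.MathematicalPhysics.QuantumLattice.FermiRG Literature.Probability.LatticeModels Literature.Analysis.SpecialFunctions
open Summit.HubbardSuperconductivity.HubbardSuperconductivity.Theorems.DispersionFlow
open Summit.HubbardSuperconductivity.HubbardSuperconductivity.Theorems.KLRegimeSplit
open Summit.HubbardSuperconductivity.HubbardSuperconductivity.Theorems.KLProgrammeLegKernels
open Summit.HubbardSuperconductivity.HubbardSuperconductivity.Theorems.PerturbedFermiCurve
open scoped Real Nat

section Closed

open Classical

variable {L M : ℕ} [NeZero L] [NeZero M] {a b : ℝ} (B : BandBounds a b) {K : TrigPolyC4v} {A : ℝ}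
  (hA : ∀ p : Momentum, ∀ j ≤ 2, ‖iteratedFDeriv ℝ j (frameShift K) p‖ ≤ A) (hADt : 2 * A < B.Dtmin)
  {μ e₀ z β : ℝ} (he : 0 < e₀) (hz : 0 < z) (hz1 : z ≤ 1) (hgap : e₀ + A + z ^ 2 < -μ) (h3 : e₀ + A - μ ≤ 3)
  (hlo : a ≤ μ - A - e₀) (hhi : μ + A + e₀ ≤ b) (hβ : 0 < β) (hρA : 4 * A < 2 * B.rhomin)
  (m : ℕ) (hMm : klScale e₀ m * β < π * (2 * M - 5))
  {d : ℝ} (hd : 0 ≤ d) (hd1 : ∀ u, |deriv (bgmCutoffSq e₀) u| ≤ d) (hd2 : ∀ u, |iteratedDeriv 2 (bgmCutoffSq e₀) u| ≤ d)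
  (hd3 : ∀ u, |iteratedDeriv 3 (bgmCutoffSq e₀) u| ≤ d)
  {A₃ a₃ : ℝ} (hA3 : ∀ p : Momentum, ‖iteratedFDeriv ℝ 3 (frameShift K) p‖ ≤ A₃) (ha3 : A₃ * klScale e₀ m ^ 2 ≤ a₃)
  {Ba : ℝ} (hB0 : 0 ≤ Ba)
  (hB : ∀ (i : ℕ), i ≤ 2 → ∀ (n : ℕ) (ω : ℤ) (θ₀ : ℝ) (q w : Fin 2 → ℝ) (t : ℝ) {r₀ : ℝ}, 0 < r₀ →
    r₀ ≤ ‖momToComplex (q + t • w)‖ → |sectorRelAngle θ₀ (q + t • w)| < π →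
    ‖iteratedDeriv i (fun t : ℝ => sectorWeightCirc n ω (polarAngle (q + t • w))) t‖ ≤
      (2 : ℕ)! * Ba * ((1 + (sectorWidth n)⁻¹ * (2 : ℕ)!) * ‖momToComplex w‖ / r₀) ^ i)
  {Ba3 : ℝ} (hB30 : 0 ≤ Ba3)
  (hB3 : ∀ (i : ℕ), i ≤ 3 → ∀ (n : ℕ) (ω : ℤ) (θ₀ : ℝ) (q w : Fin 2 → ℝ) (t : ℝ) {r₀ : ℝ}, 0 < r₀ →
    r₀ ≤ ‖momToComplex (q + t • w)‖ → |sectorRelAngle θ₀ (q + t • w)| < π →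
    ‖iteratedDeriv i (fun t : ℝ => sectorWeightCirc n ω (polarAngle (q + t • w))) t‖ ≤
      (3 : ℕ)! * Ba3 * ((1 + (sectorWidth n)⁻¹ * (3 : ℕ)!) * ‖momToComplex w‖ / r₀) ^ i)
  {Λs Λ' r : ℝ} (hΛs : 0 < Λs) (hr : 1 ≤ r) (hΛsr : klScale e₀ (m + 1) = r * Λs) (hΛΛ' : Λs ≤ Λ') (hM' : Λ' < π * (2 * M - 5) / β)
  {K₁ K₂ K₃ : ℝ} (hK₁pos : 0 < K₁) (hK₁ : ∀ p, ‖fderiv ℝ (frameLevel μ K) p‖ ≤ K₁) (hK₂ : ∀ p, ‖iteratedFDeriv ℝ 2 (frameLevel μ K) p‖ ≤ K₂)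
  (hK₃ : ∀ p, ‖iteratedFDeriv ℝ 3 (frameLevel μ K) p‖ ≤ K₃) {k₃ : ℝ} (hk₃ : K₃ * Λs ^ 2 ≤ k₃)
  {B₁ B₂ B₃ : ℝ} (hB₁ : ∀ x, |deriv salmhoferCutoff x| ≤ B₁) (hB₂ : ∀ x, |deriv (deriv salmhoferCutoff) x| ≤ B₂)
  (hB₃ : ∀ x, |deriv (deriv (deriv salmhoferCutoff)) x| ≤ B₃)
  -- regime
  (he₁ : e₀ ≤ 1) (hβM : β ≤ (M : ℝ)) (hπβ : π ≤ klScale e₀ m * β)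
  (hLz : 3 * |2 * π / L| * ((2 : ℝ) ^ (m + 1) + 1 / 2) ≤ z) (hLN : 2 * π * (2 : ℝ) ^ (m + 1) * ((2 : ℝ) ^ (m + 1) + 1 / 2) ≤ L)
  (hL1 : (2 * B.rhomin - 4 * A) * π ≤ 2 * Real.sqrt 2 * L * klScale e₀ (m + 1))
  {R₀ : ℕ} (hR₀ : 2 * (2 * (2 : ℝ) ^ (m + 1) + 1) * (R₀ : ℝ) < L) (hR₀' : (L : ℝ) / (10 * (2 : ℝ) ^ (m + 1)) ≤ R₀)
  {δL : ℝ} (hδL : 0 < δL) (hΛL : δL ≤ Λs ^ 2 * L)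
  -- the closed-form constants (instantiate with `rfl`)
  {cρ G₁ G₂ G₃ κ₃F Kp bτ ae1 ae2 av1 av2 qv Dt3 q3e q3v X₀ X₁ X₃ x₀ x₁ x₂ x₃ c₁ CW CN : ℝ}
  (hcρ : cρ = (2 * e₀ / π + B.smax * B.Dtmin * (3 / 4)) / (B.Dtmin - 2 * A) + π * Real.sqrt 2 * (1 + (4 + 2 * A) / (B.Dtmin - 2 * A)))
  (hG₁ : G₁ = d * e₀ ^ 2 * 1 + 1 * (d * e₀ ^ 2)) (hG₂ : G₂ = d * e₀ ^ 4 * 1 + 2 * (d * e₀ ^ 2) * (d * e₀ ^ 2) + 1 * (d * e₀ ^ 4))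
  (hG₃ : G₃ = d * e₀ ^ 6 * 1 + 3 * (d * e₀ ^ 4) * (d * e₀ ^ 2) + 3 * (d * e₀ ^ 2) * (d * e₀ ^ 4) + 1 * (d * e₀ ^ 6))
  (hκ₃F : κ₃F = (8 * G₃ + 12 * G₂) * (4 + 2 * A) ^ 3 + (12 * G₂ + 6 * G₁) * (4 + 2 * A) * (4 + 4 * A) * e₀ +
      2 * G₁ * (4 * e₀ ^ 2 + 8 * a₃) +
      216 * 9 * Ba3 * ((4 * G₂ + 2 * G₁) * (4 + 2 * A) ^ 2 * (2 * e₀) + 2 * G₁ * (4 + 4 * A) * e₀ * (2 * e₀)) +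
      216 * 9 * G₁ * (4 + 2 * A) * (12 * Ba3 + 72 * Ba3 ^ 2) * (2 * e₀) ^ 2 + 216 * 9 * (12 * Ba3 + 216 * Ba3 ^ 2) * (2 * e₀) ^ 3)
  (hKp : Kp = 4 + 4 * A) (hbτ : bτ = 4 + 2 * A + 2 * K₂ * (cρ * π))
  (hae1 : ae1 = G₁ * (4 + 2 * A + Kp * (cρ * π + 2)) / 2 + 72 * Ba * e₀)
  (hae2 : ae2 = (4 * G₂ + 2 * G₁) * (4 + 2 * A + Kp * (cρ * π + 2)) ^ 2 / 16 + G₁ * Kp * e₀ / 2 +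
    144 * G₁ * (4 + 2 * A + Kp * (cρ * π + 2)) * Ba * e₀ + 36 * (4 * Ba + 8 * Ba ^ 2) * e₀ ^ 2)
  (hav1 : av1 = G₁ * (4 + 2 * A + Kp * (cρ * π + 2)) / (2 * e₀) + 288 * Ba)
  (hav2 : av2 = (4 * G₂ + 2 * G₁) * (4 + 2 * A + Kp * (cρ * π + 2)) ^ 2 / (16 * e₀ ^ 2) + G₁ * Kp / (2 * e₀) +
    144 * G₁ * (4 + 2 * A + Kp * (cρ * π + 2)) * Ba / e₀ + 144 * (4 * Ba + 8 * Ba ^ 2))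
  (hqv : qv = (32 * B₂ + 144 * B₁ + 128) * (bτ + 8 * K₂) ^ 2 / (4 * (e₀ / r) ^ 2) + (16 * B₁ + 16) * K₂ / (2 * (e₀ / r)) +
    av1 * (16 * B₁ + 16) * (bτ + 6 * K₂) / (2 * (e₀ / r)) + av2)
  (hDt3 : Dt3 = 2 * (64 * B₃ + 480 * B₂ + 1728 * B₁ + 1536) + 3 * G₁ * (32 * B₂ + 144 * B₁ + 128) +
    3 / 8 * (4 * G₂ + 2 * G₁) * (16 * B₁ + 16) + (8 * G₃ + 12 * G₂) / 8)
  (hq3e : q3e = (64 * B₃ + 480 * B₂ + 1728 * B₁ + 1536) * (Real.sqrt 2 * K₁ + 12 * K₂) ^ 3 / 4 +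
    3 / 2 * (32 * B₂ + 144 * B₁ + 128) * K₂ * (Real.sqrt 2 * K₁ + 12 * K₂) * e₀ + Real.sqrt 2 / 2 * (16 * B₁ + 16) * k₃ +
    3 * ae1 * ((32 * B₂ + 144 * B₁ + 128) * (Real.sqrt 2 * K₁ + 10 * K₂) ^ 2 / 4 + (16 * B₁ + 16) * K₂ * e₀ / 2) +
    3 / 4 * ae2 * (16 * B₁ + 16) * (Real.sqrt 2 * K₁ + 8 * K₂) + κ₃F / 64)
  (hq3v : q3v = (64 * B₃ + 480 * B₂ + 1728 * B₁ + 1536) * (bτ + 12 * K₂) ^ 3 / 4 +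
    3 / 2 * (32 * B₂ + 144 * B₁ + 128) * K₂ * (bτ + 12 * K₂) * e₀ + Real.sqrt 2 / 2 * (16 * B₁ + 16) * k₃ +
    3 * (e₀ * av1 / 2) * ((32 * B₂ + 144 * B₁ + 128) * (bτ + 10 * K₂) ^ 2 / 4 + (16 * B₁ + 16) * K₂ * e₀ / 2) +
    3 / 4 * (e₀ ^ 2 * av2) * (16 * B₁ + 16) * (bτ + 8 * K₂) + κ₃F / 64)
  (hX₀ : X₀ = max 1 Dt3) (hX₁ : X₁ = max 1 q3e) (hX₃ : X₃ = max 1 q3v)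
  (hx₀ : x₀ = π * X₀ / 2) (hx₁ : x₁ = π * X₁ / 2) (hx₂ : x₂ = 5 * π / 4 * X₁) (hx₃ : x₃ = 5 * π / 4 * Real.sqrt qv)
  (hc₁ : c₁ = 4 + Kp * cρ ^ 2 * π ^ 2 / e₀)
  (hCW : CW = 64 * (1 + 5 * Real.sqrt 2 + 5 * Real.sqrt 2 * X₃) ^ 2 *
    (4096 * x₀ * (4 * ((2 * Real.sqrt 2 * x₂ + 2) * (2 * Real.sqrt 2 * x₃ + 1)) + 160 * x₁ * (x₁ + 1) ^ 2 / δL)))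
  (hCN : CN = 128 * c₁ * cρ / (π ^ 2 * (2 * B.rhomin - 4 * A)) * r ^ 2)

include B hA hADt he hz hz1 hgap h3 hlo hhi hβ hρA hMm hd hd1 hd2 hd3 hA3 ha3 hB0 hB hB30 hB3 hΛs hr hΛsr hΛΛ' hM' hK₁pos hK₁ hK₂ hK₃ hk₃ hB₁ hB₂ hB₃ he₁ hβM hπβ
  hLz hLN hL1 hR₀ hR₀' hδL hΛL hcρ hG₁ hG₂ hG₃ hκ₃F hKp hbτ hae1 hae2 hav1 hav2 hqv hDt3 hq3e hq3v hX₀ hX₁ hX₃ hx₀ hx₁ hx₂ hx₃ hc₁ hCW hCN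

set_option maxHeartbeats 3000000 in
/-- **The uniform WEIGHTED per-pair bound in closed form** (`T_max ≤ 4√(48·C_W·C_N)·(M/β)/Λ`, weight `1 + s₀|z̃₁| + s₁|z̃₂|₁` with the canonical
rates of the module docstring). [cite: BenfattoGiulianiMastropietro2006, §2.8 (2.81), §3 (3.3)] -/
theorem slicePairWt_bgmFat_closed_datum (ω ω' : Fin (sectorCount (m + 1))) :
    ∑ zz : TorusSite 1 (2 * M) × TorusSite 2 L,
        (1 + 2 * Λs * β / ((M : ℝ) * π * X₀) * |(((zz.1 0).valMinAbs : ℤ) : ℝ)| +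
            2 * Λs / (π * X₁) * |(((zz.2 0).valMinAbs : ℤ) : ℝ)| +
            2 * Λs / (π * X₁) * |(((zz.2 1).valMinAbs : ℤ) : ℝ)|) *
        ‖∑ q : TorusSite 1 (2 * M) × TorusSite 2 L, (torusChar q.1 zz.1 * torusChar q.2 zz.2) •
          ((((1 / (β * (L : ℝ) ^ 2) : ℝ) : ℂ) ^ 2 *
            (bgmFatMultiplier L M e₀ β (nambuXiCT L μ K) (m + 1) ω (⟨(q.1 0).val, ZMod.val_lt (q.1 0)⟩, q.2) *
              bgmFatMultiplier L M e₀ β (nambuXiCT L μ K) (m + 1) ω' (⟨(q.1 0).val, ZMod.val_lt (q.1 0)⟩, q.2) *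
              sliceSymbolFnXi (β * (L : ℝ) ^ 2) 0 Λs Λ' (matsubaraFreq β M ⟨(q.1 0).val, ZMod.val_lt (q.1 0)⟩)
                (nambuXiCT L μ K q.2))))‖ ≤
      4 * Real.sqrt (48 * CW * CN) * ((M : ℝ) / β) / Λs := by
  -- the scales and the tangent resolution
  have hπ := Real.pi_pos
  have hL : (0 : ℝ) < L := Nat.cast_pos.2 (Nat.pos_of_ne_zero (NeZero.ne L))
  have hMpos : (0 : ℝ) < M := lt_of_lt_of_le hβ hβM
  set Λ : ℝ := klScale e₀ (m + 1) with hΛdef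
  set Nr : ℝ := (2 : ℝ) ^ (m + 1) with hNrdef
  have hΛ : 0 < Λ := by rw [hΛdef, klScale]; positivity
  have hNr2 : 2 ≤ Nr := by
    rw [hNrdef]
    calc (2 : ℝ) = 2 ^ 1 := by norm_num
      _ ≤ 2 ^ (m + 1) := pow_le_pow_right₀ (by norm_num) (by omega)
  have hNr0 : 0 < Nr := by linarith only [hNr2]
  have hNr1 : 1 ≤ Nr := by linarith only [hNr2]
  have hNrsq : Nr ^ 2 = (4 : ℝ) ^ (m + 1) := by
    rw [hNrdef, ← pow_mul, show (4 : ℝ) = 2 ^ 2 by norm_num, ← pow_mul]; ring_nf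
  have hNrΛ : Nr ^ 2 * Λ = e₀ := by rw [hNrsq, hΛdef, klScale]; field_simp
  have hΛm : klScale e₀ m = 4 * Λ := by rw [hΛdef, klScale, klScale, pow_succ]; field_simp
  have hΛm0 : 0 < klScale e₀ m := by rw [hΛm]; positivity
  have hΛe : Λ ≤ e₀ := klScale_le_e0 he.le (m + 1)
  have hr0 : 0 < r := lt_of_lt_of_le one_pos hr
  have hΛsr' : Λ = r * Λs := by rw [hΛdef]; exact hΛsr
  have hΛsΛ : Λs ≤ Λ := by rw [hΛsr']; exact le_mul_of_one_le_left hΛs.le hr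
  have hΛse : Λs ≤ e₀ := hΛsΛ.trans hΛe
  have hΛ1 : Λs ≤ 1 := hΛse.trans he₁
  have hNrΛ' : Nr * Λ ≤ e₀ / 2 := by
    have : Nr * Λ = e₀ / Nr := by
      rw [eq_div_iff hNr0.ne', ← hNrΛ]; ring
    rw [this]; exact div_le_div_of_nonneg_left he.le (by norm_num) hNr2
  have hw : sectorWidth (m + 1) = π / Nr := by rw [sectorWidth, hNrdef]
  have hwsi : 1 + 2 * (sectorWidth (m + 1))⁻¹ ≤ 2 * Nr := by
    rw [hw, inv_div]
    have : 2 * (Nr / π) ≤ Nr := by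
      rw [mul_div_assoc']; rw [div_le_iff₀ hπ]; nlinarith only [Real.pi_gt_three, hNr0]
    linarith only [this, hNr2]
  have hwsi0 : 0 ≤ (sectorWidth (m + 1))⁻¹ := by rw [hw]; positivity
  -- constants: nonnegativity
  have hA0 : 0 ≤ A := (norm_nonneg _).trans (hA 0 0 (by norm_num))
  have hK10 : 0 ≤ K₁ := hK₁pos.le
  have hK20 : 0 ≤ K₂ := le_trans (norm_nonneg _) (hK₂ 0)
  have hK30 : 0 ≤ K₃ := le_trans (norm_nonneg _) (hK₃ 0)
  have hB10 : 0 ≤ B₁ := (abs_nonneg _).trans (hB₁ 0)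
  have hB20 : 0 ≤ B₂ := (abs_nonneg _).trans (hB₂ 0)
  have hB30' : 0 ≤ B₃ := (abs_nonneg _).trans (hB₃ 0)
  have hDt0 : 0 < B.Dtmin - 2 * A := by linarith only [hADt]
  have hγ : 0 < 2 * B.rhomin - 4 * A := by linarith only [hρA]
  have hcρ0 : 0 ≤ cρ := by rw [hcρ]; have := B.smax_pos; have := B.Dtmin_pos; positivity
  have hG₁0 : 0 ≤ G₁ := by rw [hG₁]; positivity
  have hG₂0 : 0 ≤ G₂ := by rw [hG₂]; positivity
  have hG₃0 : 0 ≤ G₃ := by rw [hG₃]; positivity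
  have hA30 : 0 ≤ A₃ := le_trans (norm_nonneg _) (hA3 0)
  have ha30 : 0 ≤ a₃ := le_trans (by positivity) ha3
  have hκ₃F0 : 0 ≤ κ₃F := by rw [hκ₃F]; positivity
  have hKp0 : 0 ≤ Kp := by rw [hKp]; positivity
  have hbτ0 : 0 ≤ bτ := by rw [hbτ]; positivity
  have hae10 : 0 ≤ ae1 := by rw [hae1]; positivity
  have hae20 : 0 ≤ ae2 := by rw [hae2]; positivity
  have hav10 : 0 ≤ av1 := by rw [hav1]; positivity
  have hav20 : 0 ≤ av2 := by rw [hav2]; positivity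
  have hqv0 : 0 < qv := by
    rw [hqv]
    have : 0 < (32 * B₂ + 144 * B₁ + 128) * (bτ + 8 * K₂) ^ 2 / (4 * (e₀ / r) ^ 2) := by
      have : 0 < bτ + 8 * K₂ := by rw [hbτ]; positivity
      positivity
    positivity
  obtain ⟨hX₀c, hX₀0⟩ := le_max_one_pow_three Dt3
  obtain ⟨hX₁c, hX₁0⟩ := le_max_one_pow_three q3e
  obtain ⟨hX₃c, hX₃0⟩ := le_max_one_pow_three q3v
  rw [← hX₀] at hX₀c hX₀0
  rw [← hX₁] at hX₁c hX₁0
  rw [← hX₃] at hX₃c hX₃0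
  have hX₁1 : 1 ≤ X₁ := by rw [hX₁]; exact le_max_left _ _
  have hx₀0 : 0 < x₀ := by rw [hx₀]; positivity
  have hx₁0 : 0 < x₁ := by rw [hx₁]; positivity
  have hx₂0 : 0 ≤ x₂ := by rw [hx₂]; positivity
  have hx₃0 : 0 ≤ x₃ := by rw [hx₃]; positivity
  have hc₁0 : 0 ≤ c₁ := by rw [hc₁]; positivity
  have hCW0 : 0 ≤ CW := by rw [hCW]; positivity
  have hCN0 : 0 ≤ CN := by rw [hCN]; positivity
  -- the steps
  set ℓ₁ : ℝ := 2 * π / L with hℓ₁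
  set ℓ : ℝ := 2 * π / L * (Nr + 1 / 2) with hℓ
  have hℓ₁0 : 0 < ℓ₁ := by positivity
  have hℓ0 : 0 < ℓ := by positivity
  have hℓNr : ℓ * Nr ≤ 1 := by
    rw [hℓ, div_mul_eq_mul_div, div_mul_eq_mul_div, div_le_one hL]; linarith only [hLN]
  have hℓle1 : ℓ ≤ 1 := le_trans (le_mul_of_one_le_right hℓ0.le hNr1) hℓNr
  have hℓ₁ℓNr : ℓ₁ ≤ ℓ / Nr := by
    rw [hℓ, hℓ₁, le_div_iff₀ hNr0]
    exact mul_le_mul_of_nonneg_left (by linarith only []) (by positivity)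
  have hℓ₁ℓ : ℓ₁ ≤ ℓ := hℓ₁ℓNr.trans (div_le_self hℓ0.le hNr1)
  have hℓ₁le1 : ℓ₁ ≤ 1 := hℓ₁ℓ.trans hℓle1
  have habs : |2 * π / (L : ℝ)| = ℓ₁ := abs_of_pos hℓ₁0
  -- the cell radius
  set ρf : ℝ := (klScale e₀ m + B.smax * B.Dtmin * (3 * sectorWidth (m + 1) / 4)) / (B.Dtmin - 2 * A) +
    π * Real.sqrt 2 * (1 + (4 + 2 * A) / (B.Dtmin - 2 * A)) * sectorWidth (m + 1) with hρf
  have hρf0 : 0 ≤ ρf := by rw [hρf]; have := B.smax_pos; have := B.Dtmin_pos; have := sectorWidth_pos (m + 1); positivity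
  have hρfb : ρf ≤ cρ * π / Nr := by
    rw [hρf, hcρ, hw, hΛm]
    have h4Λ : 4 * Λ ≤ 2 * e₀ / π * (π / Nr) := by
      have e : 2 * e₀ / π * (π / Nr) = 2 * e₀ / Nr := by field_simp
      rw [e, le_div_iff₀ hNr0]
      have := mul_le_mul_of_nonneg_left hNrΛ' (by norm_num : (0:ℝ) ≤ 4)
      linarith only [this]
    have hsm := B.smax_pos; have hdt := B.Dtmin_pos
    have e2 : ((2 * e₀ / π + B.smax * B.Dtmin * (3 / 4)) / (B.Dtmin - 2 * A) + π * Real.sqrt 2 * (1 + (4 + 2 * A) / (B.Dtmin - 2 * A))) * π / Nr =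
        (2 * e₀ / π * (π / Nr) + B.smax * B.Dtmin * (3 * (π / Nr) / 4)) / (B.Dtmin - 2 * A) +
          π * Real.sqrt 2 * (1 + (4 + 2 * A) / (B.Dtmin - 2 * A)) * (π / Nr) := by
      field_simp
    rw [e2]
    gcongr
  -- shell thickness for the support count
  have hsh : klScale e₀ m + Kp * ρf ^ 2 ≤ Λ * c₁ := by
    rw [hΛm, hc₁]
    have h1 : ρf ^ 2 ≤ (cρ * π / Nr) ^ 2 := pow_le_pow_left₀ hρf0 hρfb 2
    have h2 : Kp * ρf ^ 2 ≤ Kp * (cρ * π / Nr) ^ 2 := mul_le_mul_of_nonneg_left h1 hKp0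
    have e : Λ * (4 + Kp * cρ ^ 2 * π ^ 2 / e₀) = 4 * Λ + Kp * (cρ * π / Nr) ^ 2 := by
      rw [← hNrΛ]; field_simp
    rw [e]; linarith only [h2]
  -- the rates
  set s₀ : ℝ := 2 * Λs * β / ((M : ℝ) * π * X₀) with hs₀
  set s₁ : ℝ := 2 * Λs / (π * X₁) with hs₁
  set s₂ : ℝ := 2 * Λs / (π * (Nr + 1 / 2) * X₁) with hs₂
  set s₃ : ℝ := 2 / (π * (Nr + 1 / 2) * Nr * Real.sqrt qv) with hs₃
  set s₃' : ℝ := 2 * Λs / (π * (Nr + 1 / 2) * X₃) with hs₃'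
  have hsv : 0 < Real.sqrt qv := Real.sqrt_pos.2 hqv0
  have hs₀0 : 0 < s₀ := by positivity
  have hs₁0 : 0 < s₁ := by positivity
  have hs₂0 : 0 < s₂ := by positivity
  have hs₃0 : 0 < s₃ := by positivity
  have hs₃'0 : 0 < s₃' := by positivity
  have hsvsq : Real.sqrt qv ^ 2 = qv := Real.sq_sqrt hqv0.le
  have hc₀ : (0 : ℝ) ≤ (1 / (β * (L : ℝ) ^ 2)) ^ 2 := by positivity
  obtain ⟨hr₀, hrspace, hr₃, hr₃'⟩ := sliceRatesWt_closed_datum B hA hADt he hβ hρA m hd hA3 ha3 hB0 hB30 hΛs hr hΛsr hK₁pos hK₂ hK₃ hk₃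
    hB₁ hB₂ hB₃ hLN hcρ hG₁ hG₂ hG₃ hκ₃F hKp hbτ hae1 hae2 hav1 hav2 hqv hDt3 hq3e hq3v hX₀ hX₁ hX₃ hNrdef hℓ hρf hs₀ hs₃ hs₃'
  have hr₁ := hrspace ℓ₁ s₁ hℓ₁0 hℓ₁le1 (by rw [hs₁, hℓ₁]; field_simp)
  have hr₂ := hrspace ℓ s₂ hℓ0 hℓle1 (by rw [hs₂, hℓ]; field_simp)
  -- the integer frame vector and the per-pair theorem
  have hlo' : a ≤ μ - A := (by linarith only [hlo, he]); have hhi' : μ + A ≤ b := by linarith only [hhi, he]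
  set pF : Fin 2 → ℝ := klFermiPoint μ K (sectorCenter (m + 1) (ω : ℕ)) with hpF
  set eK : (Fin 2 → ℝ) → ℝ := fun p => frameLevel μ K (WithLp.toLp 2 p) with heK
  set g₀ : ℝ := fderiv ℝ eK pF (Pi.single 0 1) with hg₀
  set g₁ : ℝ := fderiv ℝ eK pF (Pi.single 1 1) with hg₁
  have hN0 : 0 < Real.sqrt (g₀ ^ 2 + g₁ ^ 2) := lt_of_lt_of_le hγ (gradient_floor_klFermiPoint B hA hlo' hhi' (sectorCenter (m + 1) (ω : ℕ)))
  obtain ⟨v, hv⟩ : ∃ v : Fin 2 → ℤ, v = ![round (Nr * (-g₁ / Real.sqrt (g₀ ^ 2 + g₁ ^ 2))), round (Nr * (g₀ / Real.sqrt (g₀ ^ 2 + g₁ ^ 2)))] :=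
    ⟨_, rfl⟩
  have hv0 : v 0 = round (Nr * (-g₁ / Real.sqrt (g₀ ^ 2 + g₁ ^ 2))) := (by rw [hv]; rfl); have hv1 : v 1 = round (Nr * (g₀ / Real.sqrt (g₀ ^ 2 + g₁ ^ 2))) := by rw [hv]; rfl
  obtain ⟨htan, hvj, hvne⟩ := tangentStep_bounds eK pF (norm_fderiv_frameBand_le hA μ pF) hN0 hNr1 v hv0 hv1 (2 * π / L)
  have hunit : (-g₁ / Real.sqrt (g₀ ^ 2 + g₁ ^ 2)) ^ 2 + (g₀ / Real.sqrt (g₀ ^ 2 + g₁ ^ 2)) ^ 2 = 1 := by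
    have h := (frame_orthonormal hN0).2.1
    rw [neg_div]; exact h
  have hvlen : Nr - 1 ≤ Real.sqrt ((v 0 : ℝ) ^ 2 + (v 1 : ℝ) ^ 2) := by
    have h := sub_one_le_sqrt_sum_sq_round hNr2 (u := ![-g₁ / Real.sqrt (g₀ ^ 2 + g₁ ^ 2), g₀ / Real.sqrt (g₀ ^ 2 + g₁ ^ 2)]) hunit
    rw [hv0, hv1]
    exact h
  have hT := slicePairWt_bgmFat_le B hA hADt he hz hz1 hgap h3 hlo hhi hβ hρA m hMm hd hd1 hd2 hd3 hA3 ha3 hB0 hB hB30 hB3 hΛs hΛΛ' hM' hK₁ hK₂ hK₃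
    hB₁ hB₂ hB₃ hNr2 hLz hR₀ rfl rfl rfl hG₁ hG₂ hG₃ hκ₃F hKp rfl rfl rfl rfl rfl rfl rfl rfl ω ω' v hvne hvj hvlen htan
    hs₀0 hs₁0 hs₂0 hs₃0 hs₃'0 hr₀ hr₁ hr₂ hr₃ hr₃'
  refine hT.trans ?_
  -- W and N̄s in closed form
  have h0 : 1 / s₀ = x₀ * ((M : ℝ) / β) / Λs := by rw [hs₀, hx₀]; field_simp
  have h0' : 1 ≤ 1 / s₀ := by
    rw [h0, le_div_iff₀ hΛs, hx₀]
    have hMβ : 1 ≤ (M : ℝ) / β := by rw [le_div_iff₀ hβ]; linarith only [hβM]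
    have hX1 : 1 ≤ X₀ := by rw [hX₀]; exact le_max_left _ _
    have hprod : (1 : ℝ) * 1 ≤ X₀ * ((M : ℝ) / β) := mul_le_mul hX1 hMβ zero_le_one (by positivity)
    have hge : (3 : ℝ) / 2 * (1 * 1) ≤ π / 2 * (X₀ * ((M : ℝ) / β)) := mul_le_mul (by linarith only [Real.pi_gt_three]) hprod (by norm_num) (by positivity)
    calc 1 * Λs ≤ 1 := by linarith only [hΛ1]
      _ ≤ (3 : ℝ) / 2 * (1 * 1) := by norm_num
      _ ≤ π / 2 * (X₀ * ((M : ℝ) / β)) := hge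
      _ = π * X₀ / 2 * ((M : ℝ) / β) := by ring
  have h1 : 1 / s₁ = x₁ / Λs := by rw [hs₁, hx₁]; field_simp
  have hratio : (Nr + 1 / 2) / (Nr - 1) ≤ 5 / 2 := by
    rw [div_le_iff₀ (by linarith only [hNr2])]; linarith only [hNr2]
  have hratio0 : 0 ≤ (Nr + 1 / 2) / (Nr - 1) := div_nonneg (by positivity) (by linarith only [hNr2])
  have h2 : 1 / (s₂ * (Nr - 1)) ≤ x₂ / Λs := by
    rw [hs₂, hx₂]
    have e : 1 / (2 * Λs / (π * (Nr + 1 / 2) * X₁) * (Nr - 1)) = (π / 2 * X₁) * ((Nr + 1 / 2) / (Nr - 1)) / Λs := by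
      field_simp
    rw [e]
    refine div_le_div_of_nonneg_right ?_ hΛs.le
    calc π / 2 * X₁ * ((Nr + 1 / 2) / (Nr - 1)) ≤ π / 2 * X₁ * (5 / 2) := mul_le_mul_of_nonneg_left hratio (by positivity)
      _ = 5 * π / 4 * X₁ := by ring
  have h3 : 1 / (s₃ * (Nr - 1)) ≤ x₃ * Nr := by
    rw [hs₃, hx₃]
    have e : 1 / (2 / (π * (Nr + 1 / 2) * Nr * Real.sqrt qv) * (Nr - 1)) = (π / 2 * Real.sqrt qv) * ((Nr + 1 / 2) / (Nr - 1)) * Nr := by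
      field_simp
    rw [e]
    refine mul_le_mul_of_nonneg_right ?_ hNr0.le
    calc π / 2 * Real.sqrt qv * ((Nr + 1 / 2) / (Nr - 1)) ≤ π / 2 * Real.sqrt qv * (5 / 2) := mul_le_mul_of_nonneg_left hratio (by positivity)
      _ = 5 * π / 4 * Real.sqrt qv := by ring
  have hf₂ : 2 * Real.sqrt 2 * s₁ / (s₂ * (Nr - 1)) ≤ 5 * Real.sqrt 2 := by
    have e : 2 * Real.sqrt 2 * s₁ / (s₂ * (Nr - 1)) = 2 * Real.sqrt 2 * ((Nr + 1 / 2) / (Nr - 1)) := by rw [hs₁, hs₂]; field_simp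
    rw [e]
    nlinarith only [hratio, Real.sqrt_nonneg 2]
  have hf₃ : 2 * Real.sqrt 2 * s₁ / (s₃' * (Nr - 1)) ≤ 5 * Real.sqrt 2 * X₃ := by
    have e : 2 * Real.sqrt 2 * s₁ / (s₃' * (Nr - 1)) = 2 * Real.sqrt 2 * ((Nr + 1 / 2) / (Nr - 1)) * (X₃ / X₁) := by
      rw [hs₁, hs₃']; field_simp
    rw [e]
    have hXX : X₃ / X₁ ≤ X₃ := div_le_self hX₃0.le hX₁1
    have hXX0 : 0 ≤ X₃ / X₁ := by positivity
    calc 2 * Real.sqrt 2 * ((Nr + 1 / 2) / (Nr - 1)) * (X₃ / X₁) ≤ 2 * Real.sqrt 2 * (5 / 2) * X₃ := by gcongr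
      _ = 5 * Real.sqrt 2 * X₃ := by ring
  have hW := wBracketWt_le (e₀ := e₀) (Mβ := (M : ℝ) / β) (L := (L : ℝ)) hs₀0 hs₁0 hs₂0 hs₃0 hs₃'0 hΛs hΛse he₁ hNr2 (by positivity) hx₀0.le hx₂0 hx₃0
    hδL hL h0 h0' h1 h2 h3 hΛL hR₀' (by positivity) (by positivity) hf₂ hf₃
  have eCW : 64 * (1 + 5 * Real.sqrt 2 + 5 * Real.sqrt 2 * X₃) ^ 2 *
      (4096 * x₀ * (4 * ((2 * Real.sqrt 2 * x₂ + 2) * (2 * Real.sqrt 2 * x₃ + 1)) + 160 * x₁ * (x₁ + 1) ^ 2 / δL) * ((M : ℝ) / β) * Nr / Λs ^ 2) =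
      CW * ((M : ℝ) / β) * Nr / Λs ^ 2 := by rw [hCW]; ring
  rw [eCW] at hW
  have hY₁ : 2 ≤ Real.sqrt 2 * L * ((klScale e₀ m + (4 + 4 * A) * ρf ^ 2) / (2 * B.rhomin - 4 * A)) / π := by
    have h1' : 2 ≤ Real.sqrt 2 * L * (klScale e₀ m / (2 * B.rhomin - 4 * A)) / π := by
      rw [hΛm, le_div_iff₀ hπ, mul_div_assoc', le_div_iff₀ hγ]; linarith only [hL1]
    refine h1'.trans ?_
    gcongr
    exact le_add_of_nonneg_right (by positivity)
  have hY₂ : 2 ≤ Real.sqrt 2 * L * (2 * ρf) / π := by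
    have hlow : π * Real.sqrt 2 * (π / Nr) ≤ ρf := by
      rw [hρf, hw]
      have hsm := B.smax_pos; have hdt := B.Dtmin_pos
      have h1' : 0 ≤ (klScale e₀ m + B.smax * B.Dtmin * (3 * (π / Nr) / 4)) / (B.Dtmin - 2 * A) := by positivity
      have h2' : π * Real.sqrt 2 * (π / Nr) ≤ π * Real.sqrt 2 * (1 + (4 + 2 * A) / (B.Dtmin - 2 * A)) * (π / Nr) := by
        have h1'' : (1 : ℝ) ≤ 1 + (4 + 2 * A) / (B.Dtmin - 2 * A) := by
          have : 0 ≤ (4 + 2 * A) / (B.Dtmin - 2 * A) := by positivity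
          linarith only [this]
        have h2'' := mul_le_mul_of_nonneg_left h1'' (by positivity : 0 ≤ π * Real.sqrt 2 * (π / Nr))
        linarith only [h2'']
      linarith only [h1', h2']
    have hs2 : Real.sqrt 2 * Real.sqrt 2 = 2 := Real.mul_self_sqrt (by norm_num)
    have hLNr : Nr ≤ 2 * L := by
      have h1'' : 1 ≤ 2 * π * (Nr + 1 / 2) := by nlinarith only [Real.pi_gt_three, hNr0]
      have h2'' : Nr ≤ 2 * π * Nr * (Nr + 1 / 2) := by
        calc Nr = Nr * 1 := (mul_one _).symm
          _ ≤ Nr * (2 * π * (Nr + 1 / 2)) := mul_le_mul_of_nonneg_left h1'' hNr0.le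
          _ = 2 * π * Nr * (Nr + 1 / 2) := by ring
      linarith only [h2'', hLN, hL]
    rw [le_div_iff₀ hπ]
    calc 2 * π ≤ Real.sqrt 2 * L * (2 * (π * Real.sqrt 2 * (π / Nr))) := by
          rw [show Real.sqrt 2 * L * (2 * (π * Real.sqrt 2 * (π / Nr))) = (Real.sqrt 2 * Real.sqrt 2) * 2 * π * π * L / Nr by field_simp, hs2]
          rw [le_div_iff₀ hNr0]
          have h1'' : 2 * π * Nr ≤ 2 * π * (2 * L) := mul_le_mul_of_nonneg_left hLNr (by positivity)
          have h2'' : 2 * π * (2 * L) ≤ 2 * 2 * π * π * L := by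
            have h := mul_le_mul_of_nonneg_left (show (1 : ℝ) ≤ π by linarith only [Real.pi_gt_three])
              (by positivity : (0 : ℝ) ≤ 2 * 2 * π * L)
            linarith only [h]
          linarith only [h1'', h2'']
      _ ≤ Real.sqrt 2 * L * (2 * ρf) := by gcongr
  have hNs0' := fatSupport_le (Kp := 4 + 4 * A) hΛ hβ hL hγ hNr0 hc₁0 hΛm hπβ (by rw [← hKp]; exact hsh) hρfb (by positivity) hY₁ hY₂
  have hNs : (klScale e₀ m * β / π + 1) *
      ((Real.sqrt 2 * L * ((klScale e₀ m + (4 + 4 * A) * ρf ^ 2) / (2 * B.rhomin - 4 * A)) / π + 2) * (Real.sqrt 2 * L * (2 * ρf) / π + 2)) ≤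
      CN * (β * (L : ℝ) ^ 2 * Λs ^ 2 / Nr) := by
    refine hNs0'.trans (le_of_eq ?_)
    rw [hCN, hΛsr']; field_simp
  have hW0 : 0 ≤ 524288 * (1 / s₀ + 1) *
      ((1 + 2 * Real.sqrt 2 * s₁ / (s₂ * (Nr - 1)) + 2 * Real.sqrt 2 * s₁ / (s₃' * (Nr - 1))) ^ 2 *
          ((2 * Real.sqrt 2 / (s₂ * (Nr - 1)) + 2) * (2 * Real.sqrt 2 / (s₃ * (Nr - 1)) + 2)) + (1 / s₁ + 1) ^ 2 / (1 + s₁ * R₀)) := by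
    have : 0 < Nr - 1 := by linarith only [hNr2]
    positivity
  have hNs0 : 0 ≤ (klScale e₀ m * β / π + 1) *
      ((Real.sqrt 2 * L * ((klScale e₀ m + (4 + 4 * A) * ρf ^ 2) / (2 * B.rhomin - 4 * A)) / π + 2) * (Real.sqrt 2 * L * (2 * ρf) / π + 2)) := by
    positivity
  rw [show ((2 * M : ℕ) : ℝ) = 2 * (M : ℝ) by push_cast; ring]
  exact alphaProductWt_le hW0 hNs0 hCW0 hCN0 hMpos hβ hL hΛs hNr0 hW hNs

end Closed

end Summit.HubbardSuperconductivity.HubbardSuperconductivity.Theorems.TorusFourierL2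

end
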